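import Literature.AnabelianGeometry.AbsoluteAnabelian.AbsCuspFactsProp16iiiCcn
import HarnessLib

/-!
# [AbsCusp] Prop. 1.6 (iii) as typed (FACT-LIST F-0050 / F-0045) REDUCED to its single-cusp case:
# the multi-cusp shape follows from [AbsTopIII] Prop. 1.4 (i)/(ii)-type data for each `U_x ⊇ U_S`

Proof-only companion of `AbsCuspFacts.lean` (p405610), `AbsTopIII/CurveModel.lean` and
`AbsCuspFactsProp16iiiCcn.lean` (abc-iut-f-094, p430493 + p430973; imported, never edited).  S. Mochizuki,
*Absolute anabelian cuspidalizations of proper hyperbolic curves*, J. Math. Kyoto Univ. 47 (2007)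
[AbsCusp], Prop. 1.6 (iii) p. 15 (held copy `paper:doi-10-1215-kjm-1250281022`); *Topics in absolute
anabelian geometry III* [AbsTopIII], Prop. 1.4 (i)(ii) p. 31.  Cell abc-iut, block F (fact-proving wave),
seat abc-iut-f-055 (gen 2), FACT-LIST tranche 55 (row F-0050 `AbsCusp.Prop_1_6_iii`, inside the cone).

WHAT IS PROVED (pure lattice algebra / topological group theory in `Π_{U_S}`; no curve is asserted to
exist).  Recall the typed predicate `AbsCusp.Prop_1_6_iii q I` for a homomorphism of extensions
`q : Π_{U_S} → Π_X` and a family of inertia groups `I_x`, `x ∈ S`: with `N = Ker(Δ_{U_S} ↠ Δ_X)`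
(`AbsTopIII.cuspidalKernel q`) and `C = [N, Δ_{U_S}]⁻` (`AbsTopIII.cuspidallyCentralModulus q`) it says
(a) `q` is surjective, (b) `I_x ≤ N`, (c) `(⨆ I_x) · C = N` (GENERATION), (d) each `I_x` meets
`(⨆_{y ≠ x} I_y) · C` trivially (INDEPENDENCE).  The sibling file `AbsCuspFactsProp16iiiCcn` proved
Prop. 1.6 (iii) ⇒ the single-cusp exact sequence `1 → I_x → Δ^{c-cn} → Δ_X → 1` of [AbsTopIII]
Prop. 1.4 (ii) (`IsCuspidallyCentralExtension`).  Here, conversely: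

* `iSup_icusp_sup_modulus_eq_cuspidalKernel` — clause (c) holds for ANY cuspidal data with rational
  cusps as soon as `N` is the closed normal closure of `⋃_x I_x` (the [AbsTopIII] Prop. 1.4 (i) /
  SGA1-type input "the kernel is topologically normally generated by the inertia groups of the
  cusps"; finitely many cusps, compactness of `Π`): multi-cusp version of f-094's absorption lemma.
* `icusp_inf_eq_bot_of_single_cusp_quotient` — clause (d) at the cusp `x` follows from ONE
  intermediate quotient `Π_{U_S} → Π_{U_x} → Π_X` (`r ≫ qx = q`) killing the `I_y`, `y ≠ x`, injective
  on `I_x`, carrying `I_x` into a subgroup `I'_x` for which the single-cusp central extension property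
  `IsCuspidallyCentralExtension qx I'_x` ([AbsTopIII] Prop. 1.4 (ii) shape, FACT-LIST F-0341's
  conclusion) holds — exactly the structure of the printed proof via `D_S = ∏_{Π_X} D_x` (p. 15).
* `prop_1_6_iii_of_single_cusp_quotients` — hence the typed Prop. 1.6 (iii) from (a), normal
  generation, and such single-cusp data at every cusp; and `prop_1_6_iii_iff_of_subsingleton` — for a
  single cusp the typed Prop. 1.6 (iii) IS "(a) ∧ the typed Prop. 1.4 (ii) exact sequence".

CONSEQUENCE OF RECORD (D-0026 debt accounting): the named hypothesis F-0050/F-0045 carries no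
assumption beyond the single-cusp [AbsTopIII] Prop. 1.4 (ii) shape (F-0341's conclusion at each
`U_x`) plus the Prop. 1.4 (i)-type normal-generation / functoriality data; no consumer needs to bind
both.  HONEST FRAMING: implications between the cell's TYPED predicates; nothing of [AbsCusp] /
[AbsTopIII] is proved as a statement about curves (no étale `π₁` in the tree); refereed results
typed statements-first (D-0014); typed ≠ proved; nothing here bears on the disputed [IUTchIII]
Cor. 3.12; no side taken.
-/

noncomputable section

open scoped Classical Pointwise

namespace Literature.AnabelianGeometry.AbsoluteAnabelian

universe u

namespace AbsCusp

open AbsTopIII FundamentalExtension CategoryTheory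

/-! ### Two closedness lemmas in a compact Hausdorff group -/

/-- In a compact Hausdorff topological group, if `A` normalises `K` (`[A, K] ≤ K`) and both are
closed, then `A ⊔ K = A · K` is closed (a product of two compact sets).
[cite: MochizukiAbsCusp2007, Prop 1.6 (iii) p.15] -/
theorem isClosed_coe_sup_of_commutator_le {G : Type*} [Group G] [TopologicalSpace G]
    [IsTopologicalGroup G] [CompactSpace G] [T2Space G] {A K : Subgroup G}
    (hcomm : ⁅A, K⁆ ≤ K) (hA : IsClosed (A : Set G)) (hK : IsClosed (K : Set G)) :
    IsClosed ((A ⊔ K : Subgroup G) : Set G) := by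
  rw [Subgroup.coe_mul_of_left_le_normalizer_right A K
    (Subgroup.le_normalizer_iff_commutator_le_right.mpr hcomm)]
  exact hK.mul_left_of_isCompact hA.isCompact

/-- In a compact Hausdorff topological group: for closed subgroups `I_x` (`x` in a finite set `s`)
and `K`, all contained in a subgroup `N` with `[N, N] ≤ K`, the subgroup `(⨆_{x ∈ s} I_x) ⊔ K` is
closed (induction: each step is a product with a compact subgroup normalising the previous one).
[cite: MochizukiAbsCusp2007, Prop 1.6 (iii) p.15] -/
theorem isClosed_coe_biSup_sup {G : Type*} [Group G] [TopologicalSpace G] [IsTopologicalGroup G]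
    [CompactSpace G] [T2Space G] {ι : Type*} (I : ι → Subgroup G) (N K : Subgroup G)
    (hI : ∀ x, I x ≤ N) (hK : K ≤ N) (hNN : ⁅N, N⁆ ≤ K) (hIc : ∀ x, IsClosed (I x : Set G))
    (hKc : IsClosed (K : Set G)) (s : Finset ι) :
    IsClosed ((((⨆ x ∈ s, I x) ⊔ K : Subgroup G)) : Set G) := by
  classical
  induction s using Finset.induction_on with
  | empty => simpa using hKc
  | insert a s _ ih =>
    have hL : (⨆ x ∈ s, I x) ⊔ K ≤ N := sup_le (iSup₂_le fun x _ => hI x) hK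
    rw [Finset.iSup_insert, sup_assoc]
    exact isClosed_coe_sup_of_commutator_le
      (((Subgroup.commutator_mono (hI a) hL).trans hNN).trans le_sup_right) (hIc a) ih

/-- The same for a finite index type: `(⨆_x I_x) ⊔ K` is closed.
[cite: MochizukiAbsCusp2007, Prop 1.6 (iii) p.15] -/
theorem isClosed_coe_iSup_sup {G : Type*} [Group G] [TopologicalSpace G] [IsTopologicalGroup G]
    [CompactSpace G] [T2Space G] {ι : Type*} [Finite ι] (I : ι → Subgroup G) (N K : Subgroup G)
    (hI : ∀ x, I x ≤ N) (hK : K ≤ N) (hNN : ⁅N, N⁆ ≤ K) (hIc : ∀ x, IsClosed (I x : Set G))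
    (hKc : IsClosed (K : Set G)) :
    IsClosed ((((⨆ x, I x) ⊔ K : Subgroup G)) : Set G) := by
  classical
  haveI := Fintype.ofFinite ι
  have h := isClosed_coe_biSup_sup I N K hI hK hNN hIc hKc Finset.univ
  simpa using h

/-! ### Clause (b): `I_x ≤ N` under normal generation -/

variable {E F : FundamentalExtension.{u}}

/-- If `N = Ker(Δ_{U_S} ↠ Δ_X)` is the closed normal closure of the inertia groups ([AbsTopIII]
Prop. 1.4 (i): "topologically normally generated by the inertia groups"), then `I_x ≤ N`.
[cite: MochizukiAbsTopIII2015, Prop 1.4 (i) p.31] -/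
theorem icusp_le_cuspidalKernel_of_eq_normalClosure (C : E.CuspidalData) (q : E ⟶ F)
    (hN : AbsTopIII.cuspidalKernel q =
      (Subgroup.normalClosure (⋃ x, (C.Icusp x : Set E.arith))).topologicalClosure)
    (x : C.Cusp) : C.Icusp x ≤ AbsTopIII.cuspidalKernel q := by
  rw [hN]
  intro i hi
  exact Subgroup.le_topologicalClosure _ (Subgroup.subset_normalClosure (Set.mem_iUnion.mpr ⟨x, hi⟩))

/-! ### Clause (c): GENERATION from normal generation (multi-cusp absorption) -/

/-- **Generation clause of the typed [AbsCusp] Prop. 1.6 (iii), for free.**  For cuspidal data with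
all cusps RATIONAL (`Π = D_x · Δ` for every `x`) and a homomorphism of extensions `q : Π_{U_S} → Π_X`
whose cuspidal kernel `N = Ker(Δ_{U_S} ↠ Δ_X)` is the closed normal closure of `⋃_x I_x`, one has
`(⨆_x I_x) · [N, Δ]⁻ = N`.  Proof: every `Π`-conjugate of an element of `I_x` lies in `I_x · [N, Δ]`
(f-094's `conj_icusp_mem_sup_commutator_of_isRational`), so `⟨⟨⋃ I_x⟩⟩ ≤ (⨆ I_x) ⊔ [N, Δ]⁻`; the
right side is closed (`isClosed_coe_iSup_sup`: finitely many compact `I_x`, `[N, N] ≤ [N, Δ]⁻`).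
[cite: MochizukiAbsCusp2007, Prop 1.6 (iii) p.15] -/
theorem iSup_icusp_sup_modulus_eq_cuspidalKernel (C : E.CuspidalData) (q : E ⟶ F)
    (hrat : ∀ x, C.IsRational x)
    (hN : AbsTopIII.cuspidalKernel q =
      (Subgroup.normalClosure (⋃ x, (C.Icusp x : Set E.arith))).topologicalClosure) :
    (⨆ x, C.Icusp x) ⊔ AbsTopIII.cuspidallyCentralModulus q = AbsTopIII.cuspidalKernel q := by
  haveI hNn : (AbsTopIII.cuspidalKernel q).Normal := by
    unfold AbsTopIII.cuspidalKernel
    infer_instance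
  have hle : ∀ x, C.Icusp x ≤ AbsTopIII.cuspidalKernel q := icusp_le_cuspidalKernel_of_eq_normalClosure C q hN
  have hNΔ : AbsTopIII.cuspidalKernel q ≤ E.geom := fun _ hn => (Subgroup.mem_inf.mp hn).2
  have hNc : IsClosed (AbsTopIII.cuspidalKernel q : Set E.arith) := by
    rw [hN]
    exact Subgroup.isClosed_topologicalClosure _
  have hCle : AbsTopIII.cuspidallyCentralModulus q ≤ AbsTopIII.cuspidalKernel q :=
    Subgroup.topologicalClosure_minimal _ (Subgroup.commutator_le_left _ _) hNc
  refine le_antisymm (sup_le (iSup_le hle) hCle) ?_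
  -- the normal closure of `⋃ I_x` lies in `(⨆ I_x) ⊔ [N, Δ]⁻`
  have h1 : Subgroup.normalClosure (⋃ x, (C.Icusp x : Set E.arith)) ≤
      (⨆ x, C.Icusp x) ⊔ AbsTopIII.cuspidallyCentralModulus q := by
    change Subgroup.closure (Group.conjugatesOfSet (⋃ x, (C.Icusp x : Set E.arith))) ≤ _
    rw [Subgroup.closure_le]
    intro y hy
    obtain ⟨i, hi, hc⟩ := Group.mem_conjugatesOfSet_iff.1 hy
    obtain ⟨x, hix⟩ := Set.mem_iUnion.1 hi
    obtain ⟨g, rfl⟩ := isConj_iff.1 hc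
    have h := conj_icusp_mem_sup_commutator_of_isRational C x (hrat x) (AbsTopIII.cuspidalKernel q) (hle x)
      g i hix
    exact sup_le_sup (le_iSup (fun x => C.Icusp x) x) (Subgroup.le_topologicalClosure _) h
  -- `(⨆ I_x) ⊔ [N, Δ]⁻` is closed
  have hclosed : IsClosed
      ((((⨆ x, C.Icusp x) ⊔ AbsTopIII.cuspidallyCentralModulus q : Subgroup E.arith)) : Set E.arith) :=
    isClosed_coe_iSup_sup (fun x => C.Icusp x) (AbsTopIII.cuspidalKernel q) (AbsTopIII.cuspidallyCentralModulus q)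
      hle hCle ((Subgroup.commutator_mono le_rfl hNΔ).trans (Subgroup.le_topologicalClosure _))
      (fun x => C.isClosed_Icusp x) (Subgroup.isClosed_topologicalClosure _)
  calc AbsTopIII.cuspidalKernel q
      = (Subgroup.normalClosure (⋃ x, (C.Icusp x : Set E.arith))).topologicalClosure := hN
    _ ≤ (⨆ x, C.Icusp x) ⊔ AbsTopIII.cuspidallyCentralModulus q :=
      Subgroup.topologicalClosure_minimal _ h1 hclosed

/-! ### Clause (d): INDEPENDENCE from a single-cusp quotient -/

/-- **Independence clause of the typed [AbsCusp] Prop. 1.6 (iii) at the cusp `x`, from the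
single-cusp case.**  Suppose `q : Π_{U_S} → Π_X` factors as `Π_{U_S} —r→ Π_{U_x} —qx→ Π_X` through an
extension in which the inertia groups `I_y`, `y ≠ x`, die (`I_y ≤ Ker r`), on which `I_x` injects
(`I_x ∩ Ker r = 1`) with image inside a subgroup `I'_x`, and for which the [AbsTopIII] Prop. 1.4 (ii)
exact sequence `1 → I'_x → Δ^{c-cn}_{U_x} → Δ_X → 1` holds (`IsCuspidallyCentralExtension qx I'_x`).
Then `I_x ∩ ((⨆_{y ≠ x} I_y) · [N, Δ]⁻) = 1`: `r` maps `[N, Δ]⁻` into `[N_x, Δ_x]⁻` (continuity and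
functoriality of commutators) and kills the `I_y`, so an element of the intersection maps into
`I'_x ∩ [N_x, Δ_x]⁻ = 1`, hence lies in `I_x ∩ Ker r = 1`.  This is the structure of the printed
proof (`D_S := ∏_{Π_X} D_x`, p. 15). [cite: MochizukiAbsCusp2007, Prop 1.6 (iii) p.15] -/
theorem icusp_inf_eq_bot_of_single_cusp_quotient (C : E.CuspidalData) (q : E ⟶ F) (x : C.Cusp)
    {Ex : FundamentalExtension.{u}} (r : E ⟶ Ex) (qx : Ex ⟶ F) (hfac : r ≫ qx = q)
    (Ix : Subgroup Ex.arith) (hIx : (C.Icusp x).map r.arith.toMonoidHom ≤ Ix)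
    (hkill : ∀ y, y ≠ x → C.Icusp y ≤ r.arith.toMonoidHom.ker)
    (hinj : C.Icusp x ⊓ r.arith.toMonoidHom.ker = ⊥)
    (hccn : AbsTopIII.IsCuspidallyCentralExtension qx Ix) :
    C.Icusp x ⊓ ((⨆ (y) (_ : y ≠ x), C.Icusp y) ⊔ AbsTopIII.cuspidallyCentralModulus q) = ⊥ := by
  set f : E.arith →* Ex.arith := r.arith.toMonoidHom with hf
  -- `r(N) ≤ N_x`, `r(Δ) ≤ Δ_x`
  have hN : (AbsTopIII.cuspidalKernel q).map f ≤ AbsTopIII.cuspidalKernel qx := by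
    rw [Subgroup.map_le_iff_le_comap]
    intro n hn
    obtain ⟨hn1, hn2⟩ := Subgroup.mem_inf.mp hn
    refine Subgroup.mem_inf.mpr ⟨?_, r.mapsTo_geom hn2⟩
    have h1 : q.arith n = 1 := hn1
    rw [← hfac] at h1
    exact h1
  have hΔ : E.geom.map f ≤ Ex.geom := Subgroup.map_le_iff_le_comap.mpr r.geom_le_comap
  -- `r([N, Δ]⁻) ≤ [N_x, Δ_x]⁻`
  have hCmap : AbsTopIII.cuspidallyCentralModulus q ≤ (AbsTopIII.cuspidallyCentralModulus qx).comap f := by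
    refine Subgroup.topologicalClosure_minimal _ ?_ ?_
    · rw [← Subgroup.map_le_iff_le_comap, Subgroup.map_commutator]
      exact (Subgroup.commutator_mono hN hΔ).trans (Subgroup.le_topologicalClosure _)
    · rw [Subgroup.coe_comap]
      exact (Subgroup.isClosed_topologicalClosure _).preimage r.arith.continuous
  -- `r((⨆_{y ≠ x} I_y) · [N, Δ]⁻) ≤ [N_x, Δ_x]⁻`
  have hK : (⨆ (y) (_ : y ≠ x), C.Icusp y) ⊔ AbsTopIII.cuspidallyCentralModulus q ≤
      (AbsTopIII.cuspidallyCentralModulus qx).comap f := by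
    refine sup_le (iSup₂_le fun y hy k hk => ?_) hCmap
    have hk1 : f k = 1 := hkill y hy hk
    rw [Subgroup.mem_comap, hk1]
    exact one_mem _
  -- the element chase
  rw [eq_bot_iff]
  intro j hj
  obtain ⟨hjI, hjK⟩ := Subgroup.mem_inf.mp hj
  have hfjI : f j ∈ Ix := hIx (Subgroup.mem_map_of_mem f hjI)
  have hfjC : f j ∈ AbsTopIII.cuspidallyCentralModulus qx := hK hjK
  have hfj : f j = 1 := by
    have h : f j ∈ Ix ⊓ AbsTopIII.cuspidallyCentralModulus qx := Subgroup.mem_inf.mpr ⟨hfjI, hfjC⟩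
    rw [hccn.inf_eq_bot] at h
    exact Subgroup.mem_bot.mp h
  have h : j ∈ C.Icusp x ⊓ f.ker := Subgroup.mem_inf.mpr ⟨hjI, hfj⟩
  rw [hinj] at h
  exact h

/-! ### Assembly: the typed Prop. 1.6 (iii) from single-cusp data at every cusp -/

/-- **[AbsCusp] Prop. 1.6 (iii) (typed, F-0050) from its single-cusp case.**  Let `q : Π_{U_S} → Π_X`
be a SURJECTIVE homomorphism of extensions, the cusps of `U_S` rational, `N = Ker(Δ_{U_S} ↠ Δ_X)`
the closed normal closure of the inertia groups ([AbsTopIII] Prop. 1.4 (i)), and suppose that for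
every cusp `x` the quotient `q` factors through an extension `Π_{U_x}` (`r_x ≫ q_x = q`) killing the
other inertia groups, injective on `I_x` with image in a subgroup `I'_x` satisfying the single-cusp
[AbsTopIII] Prop. 1.4 (ii) exact sequence `IsCuspidallyCentralExtension (q_x) I'_x` (FACT-LIST
F-0341's conclusion at `U_x`).  Then `AbsCusp.Prop_1_6_iii q (I_x)_x` holds: the maximal cuspidally
central quotient of `Δ_{U_S} ↠ Δ_X` has the printed shape `N/[N, Δ]⁻ = ∏_{x ∈ S} I_x`.
[cite: MochizukiAbsCusp2007, Prop 1.6 (iii) p.15] -/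
theorem prop_1_6_iii_of_single_cusp_quotients (C : E.CuspidalData) (q : E ⟶ F)
    (hq : Function.Surjective q.arith) (hrat : ∀ x, C.IsRational x)
    (hN : AbsTopIII.cuspidalKernel q =
      (Subgroup.normalClosure (⋃ x, (C.Icusp x : Set E.arith))).topologicalClosure)
    (Ex : C.Cusp → FundamentalExtension.{u}) (r : ∀ x, E ⟶ Ex x) (qx : ∀ x, Ex x ⟶ F)
    (hfac : ∀ x, r x ≫ qx x = q) (Ix : ∀ x, Subgroup (Ex x).arith)
    (hIx : ∀ x, (C.Icusp x).map (r x).arith.toMonoidHom ≤ Ix x)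
    (hkill : ∀ x y, y ≠ x → C.Icusp y ≤ (r x).arith.toMonoidHom.ker)
    (hinj : ∀ x, C.Icusp x ⊓ (r x).arith.toMonoidHom.ker = ⊥)
    (hccn : ∀ x, AbsTopIII.IsCuspidallyCentralExtension (qx x) (Ix x)) :
    Prop_1_6_iii q (fun c : C.Cusp => C.Icusp c) :=
  ⟨hq, icusp_le_cuspidalKernel_of_eq_normalClosure C q hN,
    iSup_icusp_sup_modulus_eq_cuspidalKernel C q hrat hN,
    fun x => icusp_inf_eq_bot_of_single_cusp_quotient C q x (r x) (qx x) (hfac x) (Ix x) (hIx x)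
      (hkill x) (hinj x) (hccn x)⟩

/-! ### The single-cusp case is exactly the typed [AbsTopIII] Prop. 1.4 (ii) exact sequence -/

/-- **For ONE cusp (`S = {x}`, `U_S = U_x = X ∖ {x}`) the typed [AbsCusp] Prop. 1.6 (iii) is
EQUIVALENT to "`q` surjective ∧ `1 → I_x → Δ^{c-cn}_{U_x} → Δ_X → 1` exact"** (the typed [AbsTopIII]
Prop. 1.4 (ii) shape `IsCuspidallyCentralExtension q I_x`): with a single index the join over
`y ≠ x` is trivial and `⨆_y I_y = I_x`.  (One direction is f-094's
`Prop_1_6_iii.isCuspidallyCentralExtension_of_subsingleton`.)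
[cite: MochizukiAbsCusp2007, Prop 1.6 (iii) p.15] -/
theorem prop_1_6_iii_iff_of_subsingleton {S : Type u} [Subsingleton S] (q : E ⟶ F)
    (I : S → Subgroup E.arith) (x : S) :
    Prop_1_6_iii q I ↔ Function.Surjective q.arith ∧ AbsTopIII.IsCuspidallyCentralExtension q (I x) := by
  have hbot : (⨆ (y) (_ : y ≠ x), I y) = ⊥ := by
    rw [eq_bot_iff]
    exact iSup₂_le fun y hy => absurd (Subsingleton.elim y x) hy
  have hsup : (⨆ y, I y) = I x :=
    le_antisymm (iSup_le fun y => by rw [Subsingleton.elim y x]) (le_iSup I x)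
  constructor
  · rintro ⟨hq, hle, hgen, hind⟩
    refine ⟨hq, ⟨?_, ?_⟩⟩
    · have h := hind x
      rw [hbot, bot_sup_eq] at h
      exact h
    · rw [← hsup]
      exact hgen
  · rintro ⟨hq, h⟩
    refine ⟨hq, fun y => ?_, ?_, fun y => ?_⟩
    · rw [Subsingleton.elim y x]
      exact le_sup_left.trans h.sup_eq.le
    · rw [hsup]
      exact h.sup_eq
    · have hyx : y = x := Subsingleton.elim y x
      subst hyx
      rw [hbot, bot_sup_eq]
      exact h.inf_eq_bot

/-! ### Model level: at a single-cusp open, F-0341 ([AbsTopIII] Prop. 1.4 (ii)) gives F-0045's instance -/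

/-- **F-0341 ⇒ F-0045's instance at single-cusp opens.**  For every interface `M : CurveModel`, the
model-relative [AbsTopIII] Prop. 1.4 (ii) (`CurveModel.Prop_1_4_ii M`, FACT-LIST F-0341) yields the
typed [AbsCusp] Prop. 1.6 (iii) for the datum `M.res h : Π_{U_x} → Π_X` of a cofinite open `U_x ⊆ X`
with scheme-like `U_x`, `X`, `X` proper, a SINGLE cusp `x`, rational, whose inertia group generates
the cuspidal kernel (the kernel hypothesis of F-0341, [AbsTopIII] Prop. 1.4 (i)), provided `M.res h`
is surjective ([AbsTopIII] Prop. 1.4 (i), `CurveModel.Prop_1_4_i'`).  (F-0045 `Prop_1_6_iii_model M`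
quantifies over ALL cofinite opens of proper MLF-curves; this is its one-cusp slice, BY NAME from
F-0341.) [cite: MochizukiAbsCusp2007, Prop 1.6 (iii) p.15] -/
theorem prop_1_6_iii_res_of_prop_1_4_ii {M : CurveModel.{u}} (h14 : M.Prop_1_4_ii)
    {Ux X : M.Curve} (h : M.IsCofiniteOpen Ux X) (hUs : M.IsScheme Ux) (hXs : M.IsScheme X)
    (hX : M.IsProper X) [Subsingleton (M.cusps Ux).Cusp] (x : (M.cusps Ux).Cusp)
    (hrat : (M.cusps Ux).IsRational x)
    (hN : AbsTopIII.cuspidalKernel (M.res h) =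
      (Subgroup.normalClosure ((M.cusps Ux).Icusp x : Set (M.ext Ux).arith)).topologicalClosure)
    (hsurj : Function.Surjective (M.res h).arith) :
    Prop_1_6_iii (M.res h) (fun c : (M.cusps Ux).Cusp => (M.cusps Ux).Icusp c) :=
  (prop_1_6_iii_iff_of_subsingleton (M.res h) (fun c : (M.cusps Ux).Cusp => (M.cusps Ux).Icusp c)
      x).mpr ⟨hsurj, h14 Ux X h hUs hXs hX x hrat hN⟩

end AbsCusp

end Literature.AnabelianGeometry.AbsoluteAnabelian

end
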